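import Summits.QuantumFields.YangMills.Theorems.ColdStartUniversalityShenZhuZhuTorusRectangleSU2
import Mathlib.Probability.Moments.SubGaussian
import HarnessLib

/-!
# Sub-Gaussian moment generating functions IN MATHLIB'S SENSE (`ProbabilityTheory.HasSubgaussianMGF`) for Lipschitz cylinder observables and
# Wilson loops of three-dimensional `SU(2)` lattice Yang–Mills at strong coupling — infinite-volume limit points and every torus

Seat `ym-line-csu-p1` (g38), route `ColdStartUniversality` of `Summits/QuantumFields/YangMills`, helper file G14 — interoperability: the seat's
two-sided Laplace bounds (`szz_laplace_le_su2_sharp` for limit points, `torus_laplace_su2_uniform` for every torus) say exactly that the CENTRED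
observable `F − ⟨F⟩` has a sub-Gaussian moment generating function with variance proxy `c = Σ_e ℓ_e²/K` in the sense of Mathlib's
`ProbabilityTheory.HasSubgaussianMGF` (`∫ e^{t(F−⟨F⟩)} ≤ e^{c t²/2}` for ALL real `t`, plus integrability), so that Mathlib's sub-Gaussian API (tail
bounds `HasSubgaussianMGF.measure_ge_le`, sums, …) applies verbatim to lattice Yang–Mills observables.

* ★★ `szz_hasSubgaussianMGF_su2_sharp` — limit points, 't Hooft `|β| < 1/24`: `HasSubgaussianMGF (F − ⟨F⟩_μ) (Σ_e ℓ_e²/(1 − 24|β|)) μ` for every smooth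
  `ℓ_e`-link-Lipschitz cylinder `F`.
* ★★ `szz_wilsonLoop_hasSubgaussianMGF_su2` — Wilson loops: proxy `Σ_e mult_C(e)²/(2(1 − 24|β|))` (trails: `|C|/(2(1 − 24|β|))`).
* ★★ `torus_hasSubgaussianMGF_su2_uniform` — every torus `(ℤ/L)³`, tree coupling `|β'| < 1/12`: proxy `Σ_e ℓ_e²/(1 − 12|β'|)`, the same for every `L`.
* ★★★ `torus_wilsonLoop_rect_hasSubgaussianMGF_su2` — tree vocabulary: for `wilsonMeasure (fundamentalRep (Fin 2)) β'` on `(ℤ/L)³`, every base point,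
  `i ≠ j`, `1 ≤ R, T < L`: `HasSubgaussianMGF (W_{R×T} − ⟨W_{R×T}⟩) ((R+T)/(1 − 12|β'|))` — variance proxy = PERIMETER / curvature, uniformly in `L`.

THEOREMS ONLY, no definition, no sorry.  HONEST FRAMING: STRONG coupling, fixed lattice, `SU(2)`, `d = 3`; nothing at weak coupling / in the
continuum, nothing `K`-uniform along the route's scaling (`UniformColdStartMixing`, 24809, ASIDE, not restated); no crux, rung or summit statement is
proved; the Yang–Mills mass gap is NOT proved.

References: H. Shen, R. Zhu, X. Zhu, CMP 400 (2023) 805–851 = arXiv:2204.12737, Thm 1.4 [ShenZhuZhu2022]; M. Ledoux (2001) §5.1; R. Vershynin,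
*High-dimensional probability* (2018) §2.5 (sub-Gaussian mgf).
-/

set_option autoImplicit false

noncomputable section

namespace Summit.QuantumFields.YangMills.Theorems.ColdStartUniversality

open MeasureTheory ProbabilityTheory Finset Filter Set Function
open scoped BigOperators NNReal ENNReal Topology Matrix Matrix.Norms.Frobenius ContDiff
open SimpleGraph
open Literature.Probability.LatticeModels (Site zdGraph Torus.proj Torus.proj_apply)
open Literature.Probability.Process Literature.MathematicalPhysics.QuantumFieldTheory
open Literature.MathematicalPhysics.QuantumLattice (fundamentalRep fundamentalLatticeRep continuous_fundamentalRep fundamentalRep_apply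
  torusEdge torusLift infiniteVolumeLimitPoints LGConfig normalisedCharacter wilsonLoopObs loopExpectation rectWalk length_rectWalk)
open Summit.Ventures.YMGap.RobustBall (dartMult)

/-! ## §1. Infinite-volume limit points, 't Hooft `|β| < 1/24` -/

/-- ★★ **Sub-Gaussian mgf of centred Lipschitz cylinder observables under every infinite-volume limit point, `|β| < 1/24`** (Mathlib's
`HasSubgaussianMGF`): for `F = f((U_e)_(e∈Λ))` with `f` smooth and `ℓ_e`-Lipschitz in the link `e`,
`∫ e^{t(F − ⟨F⟩_μ)} dμ ≤ e^{c t²/2}` for every real `t`, `c = Σ_e ℓ_e²/(1 − 24|β|)`.  The Yang–Mills mass gap is NOT proved.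
[cite: ShenZhuZhu2022, Theorem 1.4] -/
theorem szz_hasSubgaussianMGF_su2_sharp {β : ℝ} (hβ : |β| < 1 / 24)
    {μ : Measure (LGConfig 3 (Matrix.specialUnitaryGroup (Fin 2) ℂ))}
    (hμ : μ ∈ infiniteVolumeLimitPoints (d := 3) (fundamentalRep (Fin 2)) (((2 : ℕ) : ℝ) * β))
    (Λ : Finset (Literature.MathematicalPhysics.QuantumLattice.ZdEdge 3)) (f : (↥Λ → Matrix (Fin 2) (Fin 2) ℂ) → ℝ) (hf : ContDiff ℝ ∞ f)
    (ℓ : ↥Λ → ℝ) (hℓ : ∀ e, 0 ≤ ℓ e)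
    (hLip : ∀ (e : ↥Λ) (M M' : ↥Λ → Matrix.specialUnitaryGroup (Fin 2) ℂ), (∀ e', e' ≠ e → M e' = M' e') →
      |f (fun e' => (M e' : Matrix (Fin 2) (Fin 2) ℂ)) - f (fun e' => (M' e' : Matrix (Fin 2) (Fin 2) ℂ))| ≤ ℓ e * suFrobDist (M e) (M' e)) :
    HasSubgaussianMGF (fun U => matrixCylinder Λ f U - ∫ V, matrixCylinder Λ f V ∂μ)
      ((∑ e, ℓ e ^ 2) / (1 - 24 * |β|)).toNNReal μ := by
  classical
  obtain ⟨Ls, hLs, hprob, hlim⟩ := hμ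
  haveI := hprob
  have hμ' : μ ∈ infiniteVolumeLimitPoints (d := 3) (fundamentalRep (Fin 2)) (((2 : ℕ) : ℝ) * β) := ⟨Ls, hLs, hprob, hlim⟩
  have hK : 0 < 1 - 24 * |β| := by linarith
  have hres : Continuous fun U : LGConfig 3 (Matrix.specialUnitaryGroup (Fin 2) ℂ) =>
      (fun e' : ↥Λ => ((U e'.1 : Matrix.specialUnitaryGroup (Fin 2) ℂ) : Matrix (Fin 2) (Fin 2) ℂ)) :=
    continuous_pi fun e => continuous_subtype_val.comp (continuous_apply _)
  -- the one-sided bound for an arbitrary smooth Lipschitz profile-`ℓ` cylinder `g`, `s ≥ 0`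
  have key : ∀ (g : (↥Λ → Matrix (Fin 2) (Fin 2) ℂ) → ℝ), ContDiff ℝ ∞ g →
      (∀ (e : ↥Λ) (M M' : ↥Λ → Matrix.specialUnitaryGroup (Fin 2) ℂ), (∀ e', e' ≠ e → M e' = M' e') →
        |g (fun e' => (M e' : Matrix (Fin 2) (Fin 2) ℂ)) - g (fun e' => (M' e' : Matrix (Fin 2) (Fin 2) ℂ))| ≤ ℓ e * suFrobDist (M e) (M' e)) →
      ∀ s : ℝ, 0 ≤ s →
        ∫ U, Real.exp (s * (matrixCylinder Λ g U - ∫ V, matrixCylinder Λ g V ∂μ)) ∂μ ≤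
          Real.exp ((∑ e, ℓ e ^ 2) / (2 * (1 - 24 * |β|)) * s ^ 2) := by
    intro g hg hLipg s hs
    have h1 := szz_laplace_le_su2_sharp hβ hμ' Λ g hg ℓ hℓ hLipg hs
    have hsplit : (fun U => Real.exp (s * (matrixCylinder Λ g U - ∫ V, matrixCylinder Λ g V ∂μ))) =
        fun U => Real.exp (s * matrixCylinder Λ g U) / Real.exp (s * ∫ V, matrixCylinder Λ g V ∂μ) := by
      funext U; rw [mul_sub, Real.exp_sub]
    rw [hsplit, integral_div]
    rw [div_le_iff₀ (Real.exp_pos _), ← Real.exp_add]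
    simpa [add_comm] using h1
  refine ⟨fun t => ?_, fun t => ?_⟩
  · have hc : Continuous fun U => Real.exp (t * (matrixCylinder Λ f U - ∫ V, matrixCylinder Λ f V ∂μ)) :=
      Real.continuous_exp.comp (continuous_const.mul ((hf.continuous.comp hres).sub continuous_const))
    exact integrable_of_continuous_of_compactSpace hc _
  · have hcoe : ((((∑ e, ℓ e ^ 2) / (1 - 24 * |β|)).toNNReal : ℝ≥0) : ℝ) = (∑ e, ℓ e ^ 2) / (1 - 24 * |β|) :=
      Real.coe_toNNReal _ (by positivity)
    unfold mgf
    rw [hcoe]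
    rcases le_or_gt 0 t with ht | ht
    · refine (key f hf hLip t ht).trans (le_of_eq ?_)
      congr 1
      rw [div_mul_eq_mul_div, div_mul_eq_mul_div, div_div, mul_comm (1 - 24 * |β|) 2]
    · -- `t < 0`: apply the one-sided bound to `-f` at `-t`
      have hf' : ContDiff ℝ ∞ (fun m => - f m) := hf.neg
      have hLip' : ∀ (e : ↥Λ) (M M' : ↥Λ → Matrix.specialUnitaryGroup (Fin 2) ℂ), (∀ e', e' ≠ e → M e' = M' e') →
          |(fun m => - f m) (fun e' => (M e' : Matrix (Fin 2) (Fin 2) ℂ)) -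
              (fun m => - f m) (fun e' => (M' e' : Matrix (Fin 2) (Fin 2) ℂ))| ≤ ℓ e * suFrobDist (M e) (M' e) := by
        intro e M M' h
        simp only [neg_sub_neg]
        rw [abs_sub_comm]
        exact hLip e M M' h
      have h2 := key (fun m => - f m) hf' hLip' (-t) (by linarith)
      have hF' : ∀ U, matrixCylinder Λ (fun m => - f m) U = - matrixCylinder Λ f U := fun U => rfl
      simp_rw [hF', integral_neg] at h2
      have hrew : (fun U => Real.exp (t * (matrixCylinder Λ f U - ∫ V, matrixCylinder Λ f V ∂μ))) =
          fun U => Real.exp (-t * (-matrixCylinder Λ f U - -∫ V, matrixCylinder Λ f V ∂μ)) := by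
        funext U; congr 1; ring
      rw [hrew]
      refine h2.trans (le_of_eq ?_)
      congr 1
      rw [neg_sq, div_mul_eq_mul_div, div_mul_eq_mul_div, div_div, mul_comm (1 - 24 * |β|) 2]

/-- ★★ **Sub-Gaussian mgf of centred Wilson loops under every infinite-volume limit point, `|β| < 1/24`**: for every closed lattice walk `C`,
`HasSubgaussianMGF (W_C − ⟨W_C⟩_μ) (Σ_e mult_C(e)²/(2(1 − 24|β|))) μ`, `W_C = ½ Re tr hol_C`.  The Yang–Mills mass gap is NOT proved.
[cite: ShenZhuZhu2022, Theorem 1.4, Corollary 1.5] -/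
theorem szz_wilsonLoop_hasSubgaussianMGF_su2 {β : ℝ} (hβ : |β| < 1 / 24)
    {μ : Measure (LGConfig 3 (Matrix.specialUnitaryGroup (Fin 2) ℂ))}
    (hμ : μ ∈ infiniteVolumeLimitPoints (d := 3) (fundamentalRep (Fin 2)) (((2 : ℕ) : ℝ) * β))
    {x : Site 3} (w : (zdGraph 3).Walk x x) :
    HasSubgaussianMGF (fun U =>
        wilsonLoopObs (fun g : Matrix.specialUnitaryGroup (Fin 2) ℂ => normalisedCharacter 2 (fundamentalRep (Fin 2) g)) w U -
          loopExpectation μ (fun g : Matrix.specialUnitaryGroup (Fin 2) ℂ => normalisedCharacter 2 (fundamentalRep (Fin 2) g)) w)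
      ((∑ e ∈ walkEdges w, (dartMult w e : ℝ) ^ 2) / (2 * (1 - 24 * |β|))).toNNReal μ := by
  classical
  obtain ⟨f, hf, hrep, hLip⟩ := exists_smooth_linkLipschitz_wilsonLoopObs (N := 2) w
  set ℓ : ↥(walkEdges w) → ℝ := fun e =>
    (dartMult w (e : Literature.MathematicalPhysics.QuantumLattice.ZdEdge 3) : ℝ) / Real.sqrt ((2 : ℕ) : ℝ) with hℓdef
  have hℓ : ∀ e, 0 ≤ ℓ e := fun e => div_nonneg (Nat.cast_nonneg _) (Real.sqrt_nonneg _)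
  have hsum : ∑ e, ℓ e ^ 2 = (∑ e ∈ walkEdges w, (dartMult w e : ℝ) ^ 2) / 2 := by
    have h2 : Real.sqrt ((2 : ℕ) : ℝ) ^ 2 = 2 := by rw [Real.sq_sqrt (Nat.cast_nonneg _)]; norm_num
    simp only [hℓdef, div_pow, h2]
    rw [← Finset.sum_div, Finset.sum_coe_sort (walkEdges w) (fun e => (dartMult w e : ℝ) ^ 2)]
  have h := szz_hasSubgaussianMGF_su2_sharp hβ hμ (walkEdges w) f hf ℓ hℓ hLip
  have hF : matrixCylinder (walkEdges w) f =
      wilsonLoopObs (fun g : Matrix.specialUnitaryGroup (Fin 2) ℂ => normalisedCharacter 2 (fundamentalRep (Fin 2) g)) w := funext hrep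
  rw [hF, hsum, div_div] at h
  exact h

/-! ## §2. Every torus, tree coupling `|β'| < 1/12` -/

/-- ★★ **Sub-Gaussian mgf of centred Lipschitz cylinder observables on every torus, uniformly in the volume, `|β'| < 1/12`**:
`HasSubgaussianMGF (F − ⟨F⟩) (Σ_e ℓ_e²/(1 − 12|β'|)) μ_{L,β'}` for `F = f((U_e)_(e∈Λ)) ∘ torusLift`, `Λ` injective on the torus.
The Yang–Mills mass gap is NOT proved. [cite: ShenZhuZhu2022, Corollary 4.4 (4.11)] -/
theorem torus_hasSubgaussianMGF_su2_uniform {β' : ℝ} (hβ : |β'| < 1 / 12) (L : ℕ) [NeZero L]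
    (Λ : Finset (Literature.MathematicalPhysics.QuantumLattice.ZdEdge 3)) (hinj : Set.InjOn (torusEdge (d := 3) L) ↑Λ)
    (f : (↥Λ → Matrix (Fin 2) (Fin 2) ℂ) → ℝ) (hf : ContDiff ℝ ∞ f) (ℓ : ↥Λ → ℝ) (hℓ : ∀ e, 0 ≤ ℓ e)
    (hLip : ∀ (e : ↥Λ) (M M' : ↥Λ → Matrix.specialUnitaryGroup (Fin 2) ℂ), (∀ e', e' ≠ e → M e' = M' e') →
      |f (fun e' => (M e' : Matrix (Fin 2) (Fin 2) ℂ)) - f (fun e' => (M' e' : Matrix (Fin 2) (Fin 2) ℂ))| ≤ ℓ e * suFrobDist (M e) (M' e)) :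
    HasSubgaussianMGF (fun V => matrixCylinder Λ f (torusLift L V) - ∫ V', matrixCylinder Λ f (torusLift L V') ∂(wilsonMeasure (d := 3) (L := L) (fundamentalRep (Fin 2)) β'))
      ((∑ e, ℓ e ^ 2) / (1 - 12 * |β'|)).toNNReal (wilsonMeasure (d := 3) (L := L) (fundamentalRep (Fin 2)) β') := by
  classical
  set μ' : Measure (GaugeConfig 3 L (Matrix.specialUnitaryGroup (Fin 2) ℂ)) := (wilsonMeasure (d := 3) (L := L) (fundamentalRep (Fin 2)) β') with hμ'
  haveI : IsProbabilityMeasure μ' :=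
    isProbabilityMeasure_wilsonMeasure (d := 3) (L := L) (fundamentalRep (Fin 2)) (continuous_fundamentalRep (Fin 2)) β'
  have hK : 0 < 1 - 12 * |β'| := by linarith
  have hres : Continuous fun V : (GaugeConfig 3 L (Matrix.specialUnitaryGroup (Fin 2) ℂ)) =>
      (fun e' : ↥Λ => ((torusLift L V e'.1 : Matrix.specialUnitaryGroup (Fin 2) ℂ) : Matrix (Fin 2) (Fin 2) ℂ)) :=
    continuous_pi fun e => continuous_subtype_val.comp (continuous_apply _)
  have key : ∀ (g : (↥Λ → Matrix (Fin 2) (Fin 2) ℂ) → ℝ), ContDiff ℝ ∞ g →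
      (∀ (e : ↥Λ) (M M' : ↥Λ → Matrix.specialUnitaryGroup (Fin 2) ℂ), (∀ e', e' ≠ e → M e' = M' e') →
        |g (fun e' => (M e' : Matrix (Fin 2) (Fin 2) ℂ)) - g (fun e' => (M' e' : Matrix (Fin 2) (Fin 2) ℂ))| ≤ ℓ e * suFrobDist (M e) (M' e)) →
      ∀ s : ℝ, 0 ≤ s →
        ∫ V, Real.exp (s * (matrixCylinder Λ g (torusLift L V) - ∫ V', matrixCylinder Λ g (torusLift L V') ∂μ')) ∂μ' ≤
          Real.exp ((∑ e, ℓ e ^ 2) / (2 * (1 - 12 * |β'|)) * s ^ 2) := by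
    intro g hg hLipg s hs
    have h1 := torus_laplace_su2_uniform hβ L Λ hinj g hg ℓ hℓ hLipg hs
    have hsplit : (fun V : (GaugeConfig 3 L (Matrix.specialUnitaryGroup (Fin 2) ℂ)) => Real.exp (s * (matrixCylinder Λ g (torusLift L V) - ∫ V', matrixCylinder Λ g (torusLift L V') ∂μ'))) =
        fun V => Real.exp (s * matrixCylinder Λ g (torusLift L V)) / Real.exp (s * ∫ V', matrixCylinder Λ g (torusLift L V') ∂μ') := by
      funext V; rw [mul_sub, Real.exp_sub]
    rw [hsplit, integral_div]
    rw [div_le_iff₀ (Real.exp_pos _), ← Real.exp_add]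
    simpa [add_comm] using h1
  refine ⟨fun t => ?_, fun t => ?_⟩
  · have hc : Continuous fun V : (GaugeConfig 3 L (Matrix.specialUnitaryGroup (Fin 2) ℂ)) =>
        Real.exp (t * (matrixCylinder Λ f (torusLift L V) - ∫ V', matrixCylinder Λ f (torusLift L V') ∂μ')) :=
      Real.continuous_exp.comp (continuous_const.mul ((hf.continuous.comp hres).sub continuous_const))
    exact integrable_of_continuous_of_compactSpace hc _
  · have hcoe : ((((∑ e, ℓ e ^ 2) / (1 - 12 * |β'|)).toNNReal : ℝ≥0) : ℝ) = (∑ e, ℓ e ^ 2) / (1 - 12 * |β'|) :=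
      Real.coe_toNNReal _ (by positivity)
    unfold mgf
    rw [hcoe]
    rcases le_or_gt 0 t with ht | ht
    · refine (key f hf hLip t ht).trans (le_of_eq ?_)
      congr 1
      rw [div_mul_eq_mul_div, div_mul_eq_mul_div, div_div, mul_comm (1 - 12 * |β'|) 2]
    · have hf' : ContDiff ℝ ∞ (fun m => - f m) := hf.neg
      have hLip' : ∀ (e : ↥Λ) (M M' : ↥Λ → Matrix.specialUnitaryGroup (Fin 2) ℂ), (∀ e', e' ≠ e → M e' = M' e') →
          |(fun m => - f m) (fun e' => (M e' : Matrix (Fin 2) (Fin 2) ℂ)) -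
              (fun m => - f m) (fun e' => (M' e' : Matrix (Fin 2) (Fin 2) ℂ))| ≤ ℓ e * suFrobDist (M e) (M' e) := by
        intro e M M' h
        simp only [neg_sub_neg]
        rw [abs_sub_comm]
        exact hLip e M M' h
      have h2 := key (fun m => - f m) hf' hLip' (-t) (by linarith)
      have hF' : ∀ V : (GaugeConfig 3 L (Matrix.specialUnitaryGroup (Fin 2) ℂ)), matrixCylinder Λ (fun m => - f m) (torusLift L V) = - matrixCylinder Λ f (torusLift L V) := fun V => rfl
      simp_rw [hF', integral_neg] at h2
      have hrew : (fun V : (GaugeConfig 3 L (Matrix.specialUnitaryGroup (Fin 2) ℂ)) => Real.exp (t * (matrixCylinder Λ f (torusLift L V) - ∫ V', matrixCylinder Λ f (torusLift L V') ∂μ'))) =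
          fun V => Real.exp (-t * (-matrixCylinder Λ f (torusLift L V) - -∫ V', matrixCylinder Λ f (torusLift L V') ∂μ')) := by
        funext V; congr 1; ring
      rw [hrew]
      refine h2.trans (le_of_eq ?_)
      congr 1
      rw [neg_sq, div_mul_eq_mul_div, div_mul_eq_mul_div, div_div, mul_comm (1 - 12 * |β'|) 2]

/-- ★★★ **Sub-Gaussian mgf of centred rectangular Wilson loops on every torus, in the tree's finite-volume vocabulary**: for the periodic `SU(2)`
Wilson measure `wilsonMeasure (fundamentalRep (Fin 2)) β'` on `(ℤ/L)³` at tree coupling `|β'| < 1/12`, every torus base point `x`, every coordinate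
plane `i ≠ j` and all `1 ≤ R < L`, `1 ≤ T < L`:  `HasSubgaussianMGF (W_{R×T} − ⟨W_{R×T}⟩_{L,β'}) ((R+T)/(1 − 12|β'|)) μ_{L,β'}`,
`W_{R×T} = wilsonLoop (fundamentalRep (Fin 2)) x i j R T` — variance proxy PERIMETER/curvature, the same in every volume; Mathlib's sub-Gaussian API
(`HasSubgaussianMGF.measure_ge_le`, …) applies.  Strong coupling, fixed lattice; the Yang–Mills mass gap is NOT proved. [cite: ShenZhuZhu2022, Theorem 1.4] -/
theorem torus_wilsonLoop_rect_hasSubgaussianMGF_su2 {β' : ℝ} (hβ : |β'| < 1 / 12) (L : ℕ) [NeZero L]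
    (x : Literature.MathematicalPhysics.QuantumFieldTheory.Site 3 L) {i j : Fin 3} (hij : i ≠ j) {R T : ℕ}
    (hR : 1 ≤ R) (hT : 1 ≤ T) (hRL : R < L) (hTL : T < L) :
    HasSubgaussianMGF (fun V => wilsonLoop (fundamentalRep (Fin 2)) x i j R T V -
        wilsonExpectation (d := 3) (L := L) (fundamentalRep (Fin 2)) β' (wilsonLoop (fundamentalRep (Fin 2)) x i j R T))
      ((((R : ℝ) + T) / (1 - 12 * |β'|)).toNNReal) (wilsonMeasure (d := 3) (L := L) (fundamentalRep (Fin 2)) β') := by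
  classical
  -- lift the base point to `ℤ³`
  set x₀ : Site 3 := fun k => ((x k).val : ℤ) with hx₀
  have hx : Torus.proj L x₀ = x := by
    funext k
    rw [Torus.proj_apply, hx₀]
    simp only [Int.cast_natCast, ZMod.natCast_zmod_val]
  obtain ⟨f, hf, hrep, hLip⟩ := exists_smooth_linkLipschitz_wilsonLoopObs (N := 2) (rectWalk x₀ i j R T)
  set ℓ : ↥(walkEdges (rectWalk x₀ i j R T)) → ℝ := fun e =>
    (dartMult (rectWalk x₀ i j R T) (e : Literature.MathematicalPhysics.QuantumLattice.ZdEdge 3) : ℝ) / Real.sqrt ((2 : ℕ) : ℝ) with hℓdef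
  have hℓ : ∀ e, 0 ≤ ℓ e := fun e => div_nonneg (Nat.cast_nonneg _) (Real.sqrt_nonneg _)
  have hsum : ∑ e, ℓ e ^ 2 = (R : ℝ) + T := by
    have h2 : Real.sqrt ((2 : ℕ) : ℝ) ^ 2 = 2 := by rw [Real.sq_sqrt (Nat.cast_nonneg _)]; norm_num
    simp only [hℓdef, div_pow, h2]
    rw [← Finset.sum_div, Finset.sum_coe_sort (walkEdges (rectWalk x₀ i j R T))
      (fun e => (dartMult (rectWalk x₀ i j R T) e : ℝ) ^ 2), sum_dartMult_sq_rectWalk x₀ hij hR hT]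
    ring
  have h := torus_hasSubgaussianMGF_su2_uniform hβ L (walkEdges (rectWalk x₀ i j R T))
    (injOn_torusEdge_walkEdges_rectWalk L x₀ hij hRL hTL) f hf ℓ hℓ hLip
  have hW : ∀ V : (GaugeConfig 3 L (Matrix.specialUnitaryGroup (Fin 2) ℂ)), matrixCylinder (walkEdges (rectWalk x₀ i j R T)) f (torusLift L V) =
      wilsonLoop (fundamentalRep (Fin 2)) x i j R T V := by
    intro V; rw [hrep, wilsonLoopObs_rectWalk_torusLift, hx]
  simp_rw [hW] at h
  rw [hsum] at h
  exact h

end Summit.QuantumFields.YangMills.Theorems.ColdStartUniversality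

end
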